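import Literature.Analysis.FluidPDE.LerayHopf
import Literature.Analysis.FluidPDE.FracLaplacianSmooth
import HarnessLib

/-!
# Forced Leray–Hopf weak solutions of the fractional Navier–Stokes system on the flat torus

Analysis/FluidPDE definitions file. For an exponent `α` (the sources' `γ`, `θ`), a viscosity `ν`,
a force `f` and a datum `u₀` on the flat unit torus `T^d = UnitAddTorus d`, the system is
`∂ₜu + div(u ⊗ u) + ∇p + ν(-Δ)^α u = f`, `div u = 0` (De Rosa 2019, §1 (3): the system "with
some viscosity `ν > 0`"; Colombo–De Lellis–De Rosa 2018, §1 (NS); the tree's spectral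
`Torus.fracLaplacian α` of `FluidPDE/FractionalNSTorus`, symbol `(4π²|k|²)^α` in the unit-torus
normalisation recorded there). This file supplies the **forced, finite-horizon / global
Leray–Hopf packaging** of its weak solutions, requested by the `AnomalousDissipation` route
`FrictionOrderLadder` (support item `HypoFlexibleZerothLaw`, the "Leray–Hopf zeroth law
`Z_LH(γ)`" family): the exact twin of the tree's `α = 1` notions `Torus.IsLerayHopfOn` /
`Torus.IsGlobalLerayHopf` (`FluidPDE/LerayHopf.lean`), with

* the viscous term `+ ν⟪u, Δψ⟫` of the weak identity replaced by `- ν⟪u, (-Δ)^α ψ⟫` exactly as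
  in the tree's `Torus.IsWeakFracNSSolutionOn` (De Rosa 2019, §1, weak formulation display:
  `∫₀^∞∫ [v·∂ₜφ - v·(-Δ)^γ φ + v ⊗ v : Dφ] = -∫ v̄·φ(·,0)`), giving
  `Torus.IsWeakFracNSSolutionForcedOn T α ν f u₀ u`;
* the class `L²(0,T; H¹)` replaced by `L²(0,T; H^α)` (the tree's spectral
  `Torus.MemL2Sobolev 0 T α` of the complexified field; De Rosa 2019, §1:
  `v ∈ L^∞(ℝ⁺; L²) ∩ L²(ℝ⁺; H^γ)`);
* the dissipation `ν∫ₛᵗ ‖∇u‖₂²` of the energy inequalities replaced by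
  `ν∫ₛᵗ ∫ |(-Δ)^{α/2} u|²`, i.e. the `lintegral` of the tree's `Torus.eFracDissipation α`
  (De Rosa 2019, §1 (2); Colombo–De Lellis–De Rosa 2018, §1 (2)–(3)),

all other fields (`L^∞L²` bound, every slice in `L²`, energy inequality from `0` with the datum
and from a.e. `s ∈ (0,T)`, weak `L²`-continuity on `(0,T]` with weak limit `u₀` at `0⁺`, strong
attainment of the datum) being those of the twin, character for character:
`Torus.IsLerayHopfFracOn T α ν f u₀ u` and `Torus.IsGlobalLerayHopfFrac α ν f u₀ u := ∀ T > 0, …`.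

**At `α = 1` the notions ARE the tree's Leray–Hopf notions** (`Torus.isLerayHopfFracOn_one_iff`,
`Torus.isGlobalLerayHopfFrac_one_iff`, genuine `Iff`s): on smooth fields `(-Δ)^1 = -Δ`
(`Torus.fracLaplacian_one`, proved here from the absolutely convergent Fourier series of smooth
fields, `FracLaplacianSmooth` / `TorusFourierSeries`) and `eFracDissipation 1 = eGradNormSq`
(`Torus.eFracDissipation_one`).

**De Rosa's class (energy inequality between ALL pairs of times).** De Rosa 2019, §1 (2) asks the
energy inequality `½∫|v(t)|² + ∫ₛᵗ∫|(-Δ)^{γ/2}v|² ≤ ½∫|v(s)|²` for *all* `0 ≤ s < t`, not only for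
a.e. `s` (Colombo–De Lellis–De Rosa 2018, (3)) — the tree records the same distinction for the
unforced, `ν = 1`, `[0,∞)` packaging as `Torus.IsLerayFracSolution` vs `Torus.IsLerayHopfFracSolution`
(`FractionalNSTorus`). Here the all-pairs strengthening is the separate predicate
`Torus.IsGlobalLerayHopfFracAllPairs α ν f u₀ u := IsGlobalLerayHopfFrac α ν f u₀ u ∧ (energy
inequality from every s > 0 to every t ≥ s)` (the pair `s = 0` is the datum inequality, already a
field), so that the headline notion stays the literal twin (an `Iff` at `α = 1`, as requested for
the ladder `Z_LH(α)` to specialise to the summit's class), while statements that want De Rosa's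
class inside an `∃` (the flexible rung `γ < 1/3`) use the `AllPairs` predicate;
`IsGlobalLerayHopfFracAllPairs.isGlobalLerayHopfFrac` projects.

## Design notes

* Same shapes, binders and junk conventions as the twin (`FluidPDE/LerayHopf.lean`, "Design notes"):
  energies through `Torus.kineticEnergy` (Bochner, guarded by the field `memLp`), dissipation as
  `(∫⁻ …).toReal` of a lower Lebesgue integral, forcing term as a Bochner interval integral
  `∫ τ in s..t, ∫ x, ⟪f, u⟫` (junk `0` off integrability; consumers with `f ∈ L^∞` or `L²L²` are
  unaffected). The slice `u 0` is unconstrained beyond `u 0 ∈ L²` (the datum is `u₀`), so the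
  all-pairs predicate quantifies over `0 < s ≤ t`.
* No sign or size condition on `α`, `ν` is built in (as in the twin and in `FractionalNSTorus`);
  for `α < 0` or non-smooth arguments `fracLaplacian` carries the `tsum` junk documented there.
* Nothing here is identified with the unforced `[0, ∞)` classes `Torus.IsLerayFracSolution` /
  `Torus.IsLerayHopfFracSolution` of `FractionalNSTorus` (different packaging: tests on `[0,∞)`,
  energies in `[0,∞]`, viscosity `1`, no continuity fields).

Mathlib has no Navier–Stokes / fractional-Laplacian-on-the-torus notions (see `FractionalNSTorus`,
`LerayHopf`; searched again `LerayHopf`, `fracLaplacian`: project files only).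

## References

* L. De Rosa, *Infinitely many Leray–Hopf solutions for the fractional Navier–Stokes equations*,
  Comm. PDE 44 (2019), 335–365, §1: weak formulation, (2), (3), Thm. 1.1. [`Derosa2018`]
* M. Colombo, C. De Lellis, L. De Rosa, *Ill-posedness of Leray solutions for the hypodissipative
  Navier–Stokes equations*, Comm. Math. Phys. 362 (2018), §1 (NS), (2)–(3). [`ColomboDelellisDerosa2018`]
* J. Leray, Acta Math. 63 (1934), §III; E. Hopf, Math. Nachr. 4 (1951); G. P. Galdi (2000),
  Def. 2.1 — the Leray–Hopf packaging, as in `FluidPDE/LerayHopf.lean`.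
-/

noncomputable section

open MeasureTheory TopologicalSpace Set Function Filter Topology UnitAddTorus
open scoped InnerProductSpace RealInnerProductSpace ENNReal NNReal

namespace Literature.Analysis.FluidPDE.Torus

variable {d : Type*} [Fintype d] [DecidableEq d]

/-! ### `(-Δ)^1 = -Δ` on smooth fields -/

/-- **At `α = 1` the spectral fractional Laplacian is minus the Laplacian** on smooth real vector
fields of the torus: `(-Δ)^1 a = -Δa`. Both sides have the Fourier series
`∑ₖ 4π²|k|² â(k) e_k` — the left by definition (`Torus.hasSum_fracLaplacian`), the right by
`𝓕(Δa)(k) = -4π²|k|² â(k)` (`Torus.mFourierCoeff_complexify_laplacian`) and pointwise Fourier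
inversion of the smooth field `Δa` (`Torus.hasSum_realPart_mFourier_smul`). [folklore] -/
theorem fracLaplacian_one {a : UnitAddTorus d → EuclideanSpace ℝ d}
    (ha : FunctionSpaces.Torus.IsSmooth a) :
    fracLaplacian 1 a = -FunctionSpaces.Torus.laplacian a := by
  funext x
  have h1 := hasSum_fracLaplacian zero_le_one ha x
  have h2 := (FunctionSpaces.Torus.hasSum_realPart_mFourier_smul ha.laplacian x).neg
  rw [Pi.neg_apply]
  refine h1.unique ?_
  convert h2 using 1
  funext k
  rw [FunctionSpaces.Torus.mFourierCoeff_complexify_laplacian ha k, fracSymbol_smul_mFourier_smul,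
    fracSymbol_one, smul_neg, map_neg, neg_neg]

/-- Pointwise form of `Torus.fracLaplacian_one`: `((-Δ)^1 a)(x) = -(Δa)(x)` for smooth `a`. [folklore] -/
theorem fracLaplacian_one_apply {a : UnitAddTorus d → EuclideanSpace ℝ d}
    (ha : FunctionSpaces.Torus.IsSmooth a) (x : UnitAddTorus d) :
    fracLaplacian 1 a x = -FunctionSpaces.Torus.laplacian a x := by
  rw [fracLaplacian_one ha, Pi.neg_apply]

/-! ### Forced weak solutions with datum of the fractional system on `T^d × [0, T)` -/

/-- **Forced weak solutions with initial datum of the fractional Navier–Stokes system on the flat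
torus** `T^d × [0, T)` (`∂ₜu + div(u ⊗ u) + ∇p + ν(-Δ)^α u = f`, `div u = 0`, `u(0) = u₀`): the
tree's forced pressure-free predicate `Torus.IsWeakNSSolutionForcedOn T ν f u₀ u`
(`FluidPDE/WeakSolution.lean`: measurable, `u ∈ L²_{t,x}`, weakly divergence free for a.e. `t`,
weak momentum identity against smooth divergence-free test fields on `[0, T)` with the datum term
`+ ∫⟪u₀, ψ(0)⟫` and the force term `+ ∫∫⟪f, ψ⟫`) with the viscous term `+ ν⟪u, Δψ⟫` replaced by
`- ν⟪u, (-Δ)^α ψ⟫`, exactly as the tree's `Torus.IsWeakFracNSSolutionOn` modifies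
`Torus.IsWeakNSSolutionOn` (De Rosa 2019, §1: "`∫₀^∞∫ [v·∂ₜφ - v·(-Δ)^γ φ + v ⊗ v : Dφ] dx ds =
-∫ v̄·φ(x,0) dx` for every smooth test vector field `φ` with `div φ = 0`", here on the finite
horizon `[0, T)`, with viscosity `ν` as in his (3) and a force). At `α = 1` it is literally
`Torus.IsWeakNSSolutionForcedOn` (`isWeakFracNSSolutionForcedOn_one_iff`).
[cite: Derosa2018, §1 (weak formulation display before (2)) and (3)] -/
def IsWeakFracNSSolutionForcedOn (T α ν : ℝ) (f : ℝ → UnitAddTorus d → EuclideanSpace ℝ d)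
    (u₀ : UnitAddTorus d → EuclideanSpace ℝ d) (u : ℝ → UnitAddTorus d → EuclideanSpace ℝ d) :
    Prop :=
  AEStronglyMeasurable (FunctionSpaces.Torus.stLift u) (volume.restrict (Ioo 0 T ×ˢ univ)) ∧
    (∫⁻ t in Ioo 0 T, ∫⁻ x, ‖u t x‖ₑ ^ 2 < ∞) ∧
    (∀ᵐ t ∂(volume.restrict (Ioo 0 T)), FunctionSpaces.Torus.IsWeaklyDivFree (u t)) ∧
    ∀ ψ : ℝ → UnitAddTorus d → EuclideanSpace ℝ d, FunctionSpaces.Torus.IsSpaceTimeTest T ψ →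
      FunctionSpaces.Torus.IsDivFreeTest ψ →
      (∫ t in Ioo 0 T, ∫ x, (⟪u t x, FunctionSpaces.Torus.timeDeriv ψ t x⟫_ℝ +
        ⟪u t x, FunctionSpaces.Torus.convect (u t) (ψ t) x⟫_ℝ -
        ν * ⟪u t x, fracLaplacian α (ψ t) x⟫_ℝ + ⟪f t x, ψ t x⟫_ℝ)) + ∫ x, ⟪u₀ x, ψ 0 x⟫_ℝ = 0

/-! ### Leray–Hopf solutions of the fractional system -/

/-- **Forced Leray–Hopf weak solutions of the fractional Navier–Stokes system on the flat torus**
`T^d × [0, T)` with exponent `α`, viscosity `ν`, force `f` and datum `u₀`: the twin of the tree's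
`Torus.IsLerayHopfOn T ν f u₀ u` (`FluidPDE/LerayHopf.lean`; Leray 1934, §III; Hopf 1951; Galdi
2000, Def. 2.1) for the system `∂ₜu + div(u ⊗ u) + ∇p + ν(-Δ)^α u = f` — parallel fields, same
order, same binders — with (i) the weak form `Torus.IsWeakFracNSSolutionForcedOn` (viscous term
`-ν⟪u, (-Δ)^α ψ⟫`), (ii) the class `L²(0,T; H^α)` (spectral, `Torus.MemL2Sobolev 0 T α` of the
complexified field; De Rosa 2019, §1: `L^∞(ℝ⁺; L²) ∩ L²(ℝ⁺; H^γ)`), and (iii) the dissipation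
`ν∫ₛᵗ∫|(-Δ)^{α/2}u|²` = `ν (∫⁻ τ in Ioo s t, eFracDissipation α (u τ)).toReal` in the energy
inequalities from `s = 0` (datum `u₀`, every `t ∈ [0,T]`) and from a.e. `s ∈ (0,T)` (every
`t ∈ [s,T]`) (De Rosa 2019, §1 (2); Colombo–De Lellis–De Rosa 2018, §1 (2)–(3), there with `ν = 1`,
`f = 0`); weak `L²`-continuity on `(0,T]` with weak limit `u₀` at `0⁺` and strong attainment of the
datum as in the twin. At `α = 1` it IS `Torus.IsLerayHopfOn` (`isLerayHopfFracOn_one_iff`). The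
energy inequality between *all* pairs of times (De Rosa's class) is NOT a field: see
`Torus.IsGlobalLerayHopfFracAllPairs`. [cite: Derosa2018, §1 (2)–(3)] -/
structure IsLerayHopfFracOn (T α ν : ℝ) (f : ℝ → UnitAddTorus d → EuclideanSpace ℝ d)
    (u₀ : UnitAddTorus d → EuclideanSpace ℝ d) (u : ℝ → UnitAddTorus d → EuclideanSpace ℝ d) :
    Prop where
  /-- `u` is a forced weak (pressure-free) solution of the fractional system with datum `u₀` on
  `[0, T)` (`Torus.IsWeakFracNSSolutionForcedOn`; De Rosa 2019, §1). -/
  weak : IsWeakFracNSSolutionForcedOn T α ν f u₀ u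
  /-- `u ∈ L^∞(0, T; L²)`: `∫ ‖u(t)‖² ≤ C` for a.e. `t ∈ (0, T)` (De Rosa 2019, §1:
  `v ∈ L^∞(ℝ⁺; L²)`; Galdi 2000, Def. 2.1 (i)). -/
  energy_bound : ∃ C : ℝ≥0, ∀ᵐ t ∂(volume.restrict (Ioo 0 T)), ∫⁻ x, ‖u t x‖ₑ ^ 2 ≤ C
  /-- Every time slice is square-integrable: `u(t) ∈ L²(T^d)` for every `t ∈ [0, T]` (Galdi
  2000, Def. 2.1 and Lemma 2.2). Guards the kinetic terms of the energy inequalities. -/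
  memLp : ∀ t ∈ Icc 0 T, MemLp (u t) 2 volume
  /-- `u ∈ L²(0, T; H^α(T^d))`, spectrally (`Torus.MemL2Sobolev`, complexified field)
  (De Rosa 2019, §1: `v ∈ L²(ℝ⁺; H^γ)`, read on the finite horizon). -/
  memL2Sobolev : FunctionSpaces.Torus.MemL2Sobolev 0 T α
    (fun t => FunctionSpaces.EuclideanSpace.complexify ∘ u t)
  /-- **Energy inequality from `0`**: for every `t ∈ [0, T]`,
  `½‖u(t)‖² + ν ∫₀ᵗ ∫|(-Δ)^{α/2}u|² ≤ ½‖u₀‖² + ∫₀ᵗ ∫ ⟪f, u⟫` (De Rosa 2019, §1 (2) with `s = 0`;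
  Colombo–De Lellis–De Rosa 2018, (2)). -/
  energy_ineq_zero : ∀ t ∈ Icc 0 T,
    FunctionSpaces.Torus.kineticEnergy (u t) +
        ν * (∫⁻ τ in Ioo 0 t, eFracDissipation α (u τ)).toReal ≤
      FunctionSpaces.Torus.kineticEnergy u₀ + ∫ τ in 0..t, ∫ x, ⟪f τ x, u τ x⟫_ℝ
  /-- **Energy inequality from a.e. `s`**: for a.e. `s ∈ (0, T)` and every `t ∈ [s, T]`,
  `½‖u(t)‖² + ν ∫ₛᵗ ∫|(-Δ)^{α/2}u|² ≤ ½‖u(s)‖² + ∫ₛᵗ ∫ ⟪f, u⟫` (Colombo–De Lellis–De Rosa 2018,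
  (3); Galdi 2000, (4.3)). -/
  energy_ineq_ae : ∀ᵐ s ∂(volume.restrict (Ioo 0 T)), ∀ t ∈ Icc s T,
    FunctionSpaces.Torus.kineticEnergy (u t) +
        ν * (∫⁻ τ in Ioo s t, eFracDissipation α (u τ)).toReal ≤
      FunctionSpaces.Torus.kineticEnergy (u s) + ∫ τ in s..t, ∫ x, ⟪f τ x, u τ x⟫_ℝ
  /-- Weak continuity into `L²` on `(0, T]` with weak limit `u₀` at `0⁺` (Galdi 2000,
  Lemma 2.2; Hopf 1951). -/
  weak_continuous : ∀ w : UnitAddTorus d → EuclideanSpace ℝ d, MemLp w 2 volume →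
    ContinuousOn (fun t => ∫ x, ⟪u t x, w x⟫_ℝ) (Ioc 0 T) ∧
      Tendsto (fun t => ∫ x, ⟪u t x, w x⟫_ℝ) (𝓝[>] 0) (𝓝 (∫ x, ⟪u₀ x, w x⟫_ℝ))
  /-- The datum is attained strongly in `L²`: `‖u(t) - u₀‖₂ → 0` as `t → 0⁺` (Galdi 2000,
  Def. 2.1 (iv)). -/
  strong_initial : Tendsto (fun t => eLpNorm (u t - u₀) 2 volume) (𝓝[>] 0) (𝓝 0)

/-- **Global forced Leray–Hopf weak solutions of the fractional Navier–Stokes system on the flat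
torus** `T^d × [0, ∞)`: Leray–Hopf on `[0, T)` for every `T > 0` — the twin of the tree's
`Torus.IsGlobalLerayHopf ν f u₀ u` (Hopf 1951) for `∂ₜu + div(u ⊗ u) + ∇p + ν(-Δ)^α u = f`
(De Rosa 2019, §1, Thm. 1.1: existence on `[0, ∞)` of such solutions — unforced, `ν = 1`, in
his all-pairs class — for every divergence-free `L²` datum and every `0 < γ < 1`). At `α = 1` it
IS `Torus.IsGlobalLerayHopf` (`isGlobalLerayHopfFrac_one_iff`).
[cite: Derosa2018, §1 (2) and Thm. 1.1] -/
def IsGlobalLerayHopfFrac (α ν : ℝ) (f : ℝ → UnitAddTorus d → EuclideanSpace ℝ d)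
    (u₀ : UnitAddTorus d → EuclideanSpace ℝ d) (u : ℝ → UnitAddTorus d → EuclideanSpace ℝ d) :
    Prop :=
  ∀ T : ℝ, 0 < T → IsLerayHopfFracOn T α ν f u₀ u

/-- **De Rosa's Leray–Hopf class: the energy inequality between ALL pairs of times.** A global
forced fractional Leray–Hopf solution (`Torus.IsGlobalLerayHopfFrac`) which moreover satisfies the
energy inequality `½‖u(t)‖² + ν ∫ₛᵗ ∫|(-Δ)^{α/2}u|² ≤ ½‖u(s)‖² + ∫ₛᵗ ∫ ⟪f, u⟫` from *every*
`s > 0` to every `t ≥ s` (De Rosa 2019, §1 (2): "obeying to the global energy inequality …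
`∀ 0 ≤ s < t`"; the pair `s = 0` — with the datum `u₀` on the right — is the field
`energy_ineq_zero`, and `t = s` is trivial), as opposed to a.e. `s` only (Colombo–De Lellis–De Rosa
2018, (3), the field `energy_ineq_ae`). Global forced twin of the distinction
`Torus.IsLerayHopfFracSolution` / `Torus.IsLerayFracSolution` of `FractionalNSTorus`.
[cite: Derosa2018, §1 (2)] -/
def IsGlobalLerayHopfFracAllPairs (α ν : ℝ) (f : ℝ → UnitAddTorus d → EuclideanSpace ℝ d)
    (u₀ : UnitAddTorus d → EuclideanSpace ℝ d) (u : ℝ → UnitAddTorus d → EuclideanSpace ℝ d) :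
    Prop :=
  IsGlobalLerayHopfFrac α ν f u₀ u ∧
    ∀ s t : ℝ, 0 < s → s ≤ t →
      FunctionSpaces.Torus.kineticEnergy (u t) +
          ν * (∫⁻ τ in Ioo s t, eFracDissipation α (u τ)).toReal ≤
        FunctionSpaces.Torus.kineticEnergy (u s) + ∫ τ in s..t, ∫ x, ⟪f τ x, u τ x⟫_ℝ

variable {T α ν : ℝ} {f u : ℝ → UnitAddTorus d → EuclideanSpace ℝ d}
  {u₀ : UnitAddTorus d → EuclideanSpace ℝ d}

/-! ### API -/

/-- **At `α = 1` the forced fractional weak formulation is the tree's forced weak formulation**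
`Torus.IsWeakNSSolutionForcedOn`: on the (smooth) slices of a test field `(-Δ)^1 ψ = -Δψ`
(`Torus.fracLaplacian_one`), so `-ν⟪u, (-Δ)^1 ψ⟫ = ν⟪u, Δψ⟫`. [folklore] -/
theorem isWeakFracNSSolutionForcedOn_one_iff :
    IsWeakFracNSSolutionForcedOn T 1 ν f u₀ u ↔ IsWeakNSSolutionForcedOn T ν f u₀ u := by
  unfold IsWeakFracNSSolutionForcedOn IsWeakNSSolutionForcedOn
  refine and_congr_right fun _ => and_congr_right fun _ => and_congr_right fun _ => ?_
  refine forall_congr' fun ψ => imp_congr_right fun hψ => ?_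
  have h : ∀ t x, fracLaplacian 1 (ψ t) x = -FunctionSpaces.Torus.laplacian (ψ t) x :=
    fun t x => fracLaplacian_one_apply (hψ.isSmooth_slice t) x
  simp only [h, inner_neg_right, mul_neg, sub_neg_eq_add]

/-- Testing an unforced fractional weak solution with datum against test fields supported in the
open interval `(0, T)` (which vanish at `t = 0`) gives the tree's `Torus.IsWeakFracNSSolutionOn`
(`FractionalNSTorus`; Luo–Titi 2020, Def. 1.1 on a finite interval). [folklore] -/
theorem IsWeakFracNSSolutionForcedOn.isWeakFracNSSolutionOn
    (h : IsWeakFracNSSolutionForcedOn T α ν 0 u₀ u) : IsWeakFracNSSolutionOn T α ν u := by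
  refine ⟨h.1, h.2.1, h.2.2.1, fun ψ hψ hdiv => ?_⟩
  have := h.2.2.2 ψ hψ.isSpaceTimeTest hdiv
  simpa [hψ.apply_zero] using this

/-- A fractional Leray–Hopf solution is in particular a forced weak solution with datum
(projection of the field `weak`). [folklore] -/
theorem IsLerayHopfFracOn.isWeakFracNSSolutionForcedOn (h : IsLerayHopfFracOn T α ν f u₀ u) :
    IsWeakFracNSSolutionForcedOn T α ν f u₀ u :=
  h.weak

/-- A fractional Leray–Hopf solution lies in `L²(0, T; H^α)` (spectral; projection of the field
`memL2Sobolev`; De Rosa 2019, §1). [folklore] -/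
theorem IsLerayHopfFracOn.memL2Sobolev_alpha (h : IsLerayHopfFracOn T α ν f u₀ u) :
    FunctionSpaces.Torus.MemL2Sobolev 0 T α (fun t => FunctionSpaces.EuclideanSpace.complexify ∘ u t) :=
  h.memL2Sobolev

/-- **At `α = 1` fractional Leray–Hopf IS Leray–Hopf** (`Torus.IsLerayHopfOn` of
`FluidPDE/LerayHopf.lean`): the weak forms agree (`isWeakFracNSSolutionForcedOn_one_iff`) and the
dissipations agree (`Torus.eFracDissipation_one : eFracDissipation 1 = eGradNormSq`); all other
fields are literally the same. [folklore] -/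
theorem isLerayHopfFracOn_one_iff : IsLerayHopfFracOn T 1 ν f u₀ u ↔ IsLerayHopfOn T ν f u₀ u := by
  constructor
  · rintro ⟨hw, hb, hm, hs, h0, hae, hwc, hsi⟩
    refine ⟨isWeakFracNSSolutionForcedOn_one_iff.1 hw, hb, hm, hs, ?_, ?_, hwc, hsi⟩
    · simpa only [eFracDissipation_one] using h0
    · simpa only [eFracDissipation_one] using hae
  · rintro ⟨hw, hb, hm, hs, h0, hae, hwc, hsi⟩
    refine ⟨isWeakFracNSSolutionForcedOn_one_iff.2 hw, hb, hm, hs, ?_, ?_, hwc, hsi⟩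
    · simpa only [eFracDissipation_one] using h0
    · simpa only [eFracDissipation_one] using hae

/-- A global fractional Leray–Hopf solution is one on every `[0, T)`, `T > 0` (definitional). [folklore] -/
theorem IsGlobalLerayHopfFrac.isLerayHopfFracOn (h : IsGlobalLerayHopfFrac α ν f u₀ u)
    (hT : 0 < T) : IsLerayHopfFracOn T α ν f u₀ u :=
  h T hT

/-- **At `α = 1` global fractional Leray–Hopf IS global Leray–Hopf** (`Torus.IsGlobalLerayHopf`,
the solution class of the summit statement `Literature.Turb.ZerothLaw`). [folklore] -/
theorem isGlobalLerayHopfFrac_one_iff :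
    IsGlobalLerayHopfFrac 1 ν f u₀ u ↔ IsGlobalLerayHopf ν f u₀ u :=
  forall₂_congr fun _ _ => isLerayHopfFracOn_one_iff

/-- De Rosa's all-pairs class projects onto the (a.e.-`s`) fractional Leray–Hopf class. [folklore] -/
theorem IsGlobalLerayHopfFracAllPairs.isGlobalLerayHopfFrac
    (h : IsGlobalLerayHopfFracAllPairs α ν f u₀ u) : IsGlobalLerayHopfFrac α ν f u₀ u :=
  h.1

/-- The all-pairs energy inequality of De Rosa's class, from every `s > 0` to every `t ≥ s`
(projection; De Rosa 2019, §1 (2)). [folklore] -/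
theorem IsGlobalLerayHopfFracAllPairs.energy_ineq (h : IsGlobalLerayHopfFracAllPairs α ν f u₀ u)
    {s t : ℝ} (hs : 0 < s) (hst : s ≤ t) :
    FunctionSpaces.Torus.kineticEnergy (u t) +
        ν * (∫⁻ τ in Ioo s t, eFracDissipation α (u τ)).toReal ≤
      FunctionSpaces.Torus.kineticEnergy (u s) + ∫ τ in s..t, ∫ x, ⟪f τ x, u τ x⟫_ℝ :=
  h.2 s t hs hst

/-- At `α = 1` a solution in De Rosa's all-pairs class is a global Leray–Hopf solution in the
tree's sense (`Torus.IsGlobalLerayHopf`). [folklore] -/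
theorem IsGlobalLerayHopfFracAllPairs.isGlobalLerayHopf
    (h : IsGlobalLerayHopfFracAllPairs 1 ν f u₀ u) : IsGlobalLerayHopf ν f u₀ u :=
  isGlobalLerayHopfFrac_one_iff.1 h.1

end Literature.Analysis.FluidPDE.Torus
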